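import Summits.Ventures.YMGap.RobustBall.PerturbedCovariance
import Summits.Ventures.YMGap.RobustBall.MassGapOnBallZdG
import Summits.Ventures.YMGap.RobustBall.MassGapOnBallS
import Summits.Ventures.YMGap.RobustBall.AdjointWitness
import Summits.Ventures.YMGap.Thresholds.ImprovedThresholdStar
import Summits.Ventures.YMGap.Thresholds.SharpStrongCouplingFree
import HarnessLib

/-!
# Venture YMGap, track ROBUST-BALL — ONE STATE, step 10: the one state of a translation-covariant member is
# TRANSLATION INVARIANT; the Bhanot–Creutz mixed action as a covariant member

HONEST FRAMING. WHAT THIS IS: a venture file (cell `pub-ymgap`, track Y2 ROBUST-BALL, seat ds-3) reading the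
translation covariance of `PerturbedCovariance.lean` in the cell's currencies. In the uniqueness regime — the first
clause of `PerturbedMassGapAt` (tier 1), `PerturbedMassGapAtS` (tier 2, possibly infinite range), `MassGapAt` (Wilson)
— the one DLR state `μ` of a member whose finite-volume Hamiltonians are translation covariant
(`H^W_{Λ+v} ∘ θ_v = H^W_Λ`; tier 2: `W_{X+v} ∘ θ_v = W_X`) satisfies `μ ∘ θ_v⁻¹ = μ` for every `v ∈ ℤ^d`
(`IsZdTranslationInvariant μ`): `oneState_translationInvariant_of_perturbedMassGapAt` / `_onBallZdG` /
`_of_perturbedMassGapAtS` / `_onBallZdS` / `_of_massGapAt`. No Van Hove join is needed, so the tier-2 cells get it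
too. CONCRETE COVARIANT MEMBER: rb-p1's adjoint-plaquette witness `adjointWitness t` (the `SU(N)` term
`t · (Re tr U_p / N)²` on every plaquette, support family `plaquetteSupp`) is translation covariant
(`adjointWitness_shift`, `plaquetteSupp_shift`, `hamiltonianIn_adjointWitness_shift`; the plaquette is recovered from
its link set, `plaquetteEdges_injective`), so ★ the unique DLR state of the `SU(2)` Bhanot–Creutz MIXED
fundamental–adjoint action at `β_W = 1/8`, `|t| ≤ 1/100` (rb-p1's `su2_mixedAction_massGap_1_8`) is translation
invariant (`su2_mixedAction_oneState_translationInvariant`). WILSON CELLS: `SU(2)` `ℤ⁴` at every `|b| ≤ 9/50` (Wilson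
`|β_W| ≤ 9/25`, two-sided) and every `N ≥ 2`, `d ≥ 2` at 't Hooft `|β| < 1/(8d)`: the unique DLR state is translation
invariant (the tree had this conclusion for the periodic LIMIT state via `StrongCouplingPhaseAt`; here it is read on
the DLR side, `𝒢 = {μ}`). WHAT THIS IS NOT: no claim for members that are not translation covariant (a single bump
`W` breaks the symmetry and its one state is NOT invariant in general); lattice statements only, nothing about the
continuum limit or the Clay Millennium problem.

References: H.-O. Georgii (2011), §5.1; G. Bhanot, M. Creutz, Phys. Rev. D 24 (1981) 3212 (the mixed action); the
track's `PerturbedCovariance.lean`, `AdjointWitness.lean`, `MassGapOnBall*.lean`; `Thresholds/ImprovedThresholdStar.lean`,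
`Thresholds/SharpStrongCouplingFree.lean`.
-/

noncomputable section

open MeasureTheory Filter Function
open Literature.Probability.LatticeModels hiding configShift configShift_apply
open Literature.MathematicalPhysics.QuantumLattice
open Literature.MathematicalPhysics.QuantumFieldTheory hiding ZdEdge
open Summit.QuantumFields.YangMills.Theorems.NonSimplyConnectedLatticeGap
  (plaquetteEdges_shift plaquettesTouching_map_edgeShift plaquetteObs_add_configShift ymSpecification_map_configShift)

namespace Summit.Ventures.YMGap.RobustBall

/-! ### The currencies: one state, translation invariant -/

section Currencies

variable {d N : ℕ}

/-- ★★ **TIER 1: THE ONE STATE OF A TRANSLATION-COVARIANT MEMBER IS TRANSLATION INVARIANT.** Under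
`PerturbedMassGapAt d N β W supp` (continuous terms reading their own links, locally finite support) and translation
covariance of the finite-volume Hamiltonians, `perturbedGibbsMeasures = {μ}` with `μ ∘ θ_v⁻¹ = μ` for all `v ∈ ℤ^d`.
[folklore] -/
theorem oneState_translationInvariant_of_perturbedMassGapAt {β : ℝ} {W : Potential (ZdEdge d) (SUN N)}
    {supp : Finset (ZdEdge d) → Finset (Finset (ZdEdge d))} (hgap : PerturbedMassGapAt d N β W supp)
    (hWc : ∀ X, Continuous (W X)) (hdep : ∀ X, DependsOn (W X) (↑X : Set (ZdEdge d)))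
    (hsupp : W.IsSupportedBy supp)
    (hH : ∀ (Λ : Finset (ZdEdge d)) (v : Site d) (U : LGConfig d (SUN N)),
      hamiltonianIn W supp (Λ.map (edgeShift v).toEmbedding) (configShift v U) = hamiltonianIn W supp Λ U) :
    ∃ μ : Measure (LGConfig d (SUN N)),
      perturbedGibbsMeasures (d := d) (fundamentalRep (Fin N)) ((N : ℝ) * β) W supp = {μ} ∧
        IsZdTranslationInvariant μ := by
  obtain ⟨hsub, ⟨μ, hμ⟩⟩ := hgap.1
  exact ⟨μ, Set.eq_singleton_iff_unique_mem.2 ⟨hμ, fun ν hν => hsub hν hμ⟩,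
    Covariance.isZdTranslationInvariant_of_subsingleton_perturbedYM _ (continuous_fundamentalRep (Fin N)) _ hWc
      hdep hsupp hH hsub hμ⟩

/-- ★★ **BALL FORM** (gauge-invariant tier-1 `ℤ^d` ball): a `MassGapOnBallZdG d N β ε₀ ε₁ R` row gives, for every
member `(W, supp) ∈ MemBallZdG ε₀ ε₁ R` with translation-covariant Hamiltonians, ONE translation-invariant state.
[folklore] -/
theorem oneState_translationInvariant_onBallZdG {β ε₀ ε₁ : ℝ} {R : ℕ} (hgap : MassGapOnBallZdG d N β ε₀ ε₁ R)
    {W : Potential (ZdEdge d) (SUN N)} {supp : Finset (ZdEdge d) → Finset (Finset (ZdEdge d))}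
    (hmem : MemBallZdG ε₀ ε₁ R W supp)
    (hH : ∀ (Λ : Finset (ZdEdge d)) (v : Site d) (U : LGConfig d (SUN N)),
      hamiltonianIn W supp (Λ.map (edgeShift v).toEmbedding) (configShift v U) = hamiltonianIn W supp Λ U) :
    ∃ μ : Measure (LGConfig d (SUN N)),
      perturbedGibbsMeasures (d := d) (fundamentalRep (Fin N)) ((N : ℝ) * β) W supp = {μ} ∧
        IsZdTranslationInvariant μ :=
  oneState_translationInvariant_of_perturbedMassGapAt (hgap W supp hmem) hmem.continuous hmem.dependsOn
    hmem.supportedBy hH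

/-- ★★ **TIER 2 (link-summable, possibly infinite-range members): the one state of a translation-covariant
member `W_{X+v} ∘ θ_v = W_X` is translation invariant** — no Van Hove join needed. [folklore] -/
theorem oneState_translationInvariant_of_perturbedMassGapAtS {β : ℝ} {W : Potential (ZdEdge d) (SUN N)}
    (hgap : PerturbedMassGapAtS d N β W) {B : Finset (ZdEdge d) → ℝ} (hB : IsLinkSummable W B)
    (hWc : ∀ X, Continuous (W X)) (hdep : ∀ X, DependsOn (W X) (↑X : Set (ZdEdge d)))
    (hW : ∀ (v : Site d) (X : Finset (ZdEdge d)) (U : LGConfig d (SUN N)),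
      W (X.map (edgeShift v).toEmbedding) (configShift v U) = W X U) :
    ∃ μ : Measure (LGConfig d (SUN N)),
      perturbedGibbsMeasuresS (d := d) (fundamentalRep (Fin N)) ((N : ℝ) * β) W = {μ} ∧ IsZdTranslationInvariant μ := by
  obtain ⟨hsub, ⟨μ, hμ⟩⟩ := hgap.1
  exact ⟨μ, Set.eq_singleton_iff_unique_mem.2 ⟨hμ, fun ν hν => hsub hν hμ⟩,
    Covariance.isZdTranslationInvariant_of_subsingleton_perturbedYMS _ (continuous_fundamentalRep (Fin N)) _ hB hWc
      hdep hW hsub hμ⟩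

/-- ★★ **TIER-2 BALL FORM**: a `MassGapOnBallZdS d N β a Λ t` row gives, for every translation-covariant member
`W ∈ MemBallZdS a Λ t`, ONE translation-invariant state. [folklore] -/
theorem oneState_translationInvariant_onBallZdS {β a Λ t : ℝ} (hgap : MassGapOnBallZdS d N β a Λ t)
    {W : Potential (ZdEdge d) (SUN N)} (hmem : MemBallZdS a Λ t W)
    (hW : ∀ (v : Site d) (X : Finset (ZdEdge d)) (U : LGConfig d (SUN N)),
      W (X.map (edgeShift v).toEmbedding) (configShift v U) = W X U) :
    ∃ μ : Measure (LGConfig d (SUN N)),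
      perturbedGibbsMeasuresS (d := d) (fundamentalRep (Fin N)) ((N : ℝ) * β) W = {μ} ∧ IsZdTranslationInvariant μ := by
  obtain ⟨B, hB⟩ := hmem.summable
  exact oneState_translationInvariant_of_perturbedMassGapAtS (hgap W hmem) hB hmem.continuous hmem.dependsOn hW

/-- ★★ **WILSON ACTION** (every `d`, `N`): under `MassGapAt d N β` the unique DLR state of `SU(N)` lattice Yang–Mills at
tree coupling `N β` is translation invariant (kernel covariance: the tree's `ymSpecification_map_configShift`).
[folklore] -/
theorem oneState_translationInvariant_of_massGapAt {β : ℝ} (hgap : MassGapAt d N β) :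
    ∃ μ : Measure (LGConfig d (SUN N)),
      ymGibbsMeasures (d := d) (fundamentalRep (Fin N)) ((N : ℝ) * β) = {μ} ∧ IsZdTranslationInvariant μ := by
  obtain ⟨hsub, ⟨μ, hμ⟩⟩ := hgap.1
  have hρ : Continuous (fundamentalRep (Fin N)) := continuous_fundamentalRep (Fin N)
  exact ⟨μ, Set.eq_singleton_iff_unique_mem.2 ⟨hμ, fun ν hν => hsub hν hμ⟩,
    Covariance.isZdTranslationInvariant_of_subsingleton (isSpecification_ymSpecification_of_t2Space (d := d) _ hρ _)
      (fun Λ v η => ymSpecification_map_configShift _ hρ _ Λ v η) hsub hμ⟩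

/-- ★ **`SU(2)` Wilson on `ℤ⁴`, TWO-SIDED**: at every tree coupling `|b| ≤ 9/50` (Wilson `|β_W| ≤ 9/25`) the unique
DLR state is translation invariant (uniqueness: `su2_hasUniqueGibbsMeasure_of_abs_le`). [folklore] -/
theorem su2_wilson_oneState_translationInvariant {b : ℝ} (h : |b| ≤ 9 / 50) :
    ∃ μ : Measure (LGConfig 4 (SUN 2)),
      ymGibbsMeasures (d := 4) (fundamentalRep (Fin 2)) b = {μ} ∧ IsZdTranslationInvariant μ := by
  obtain ⟨hsub, ⟨μ, hμ⟩⟩ := ImprovedThresholdStar.su2_hasUniqueGibbsMeasure_of_abs_le h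
  have hρ : Continuous (fundamentalRep (Fin 2)) := continuous_fundamentalRep (Fin 2)
  exact ⟨μ, Set.eq_singleton_iff_unique_mem.2 ⟨hμ, fun ν hν => hsub hν hμ⟩,
    Covariance.isZdTranslationInvariant_of_subsingleton (isSpecification_ymSpecification_of_t2Space (d := 4) _ hρ _)
      (fun Λ v η => ymSpecification_map_configShift _ hρ _ Λ v η) hsub hμ⟩

/-- ★ **Every `N ≥ 2`, every `d ≥ 2`, the SHARP window, hypothesis-free**: at every 't Hooft `|β| < 1/(8d)` the unique
DLR state of `SU(N)` lattice Yang–Mills on `ℤ^d` is translation invariant (p1's `massGapAt_sharp_free`). [folklore] -/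
theorem suN_wilson_oneState_translationInvariant_sharp (hd : 2 ≤ d) (hN : 2 ≤ N) {β : ℝ}
    (hβ : |β| < HessianSharp.sharpThresholdSU d) :
    ∃ μ : Measure (LGConfig d (SUN N)),
      ymGibbsMeasures (d := d) (fundamentalRep (Fin N)) ((N : ℝ) * β) = {μ} ∧ IsZdTranslationInvariant μ :=
  oneState_translationInvariant_of_massGapAt (SharpUniquenessJoin.massGapAt_sharp_free hd hN hβ)

end Currencies

/-! ### A concrete covariant member: the adjoint-plaquette witness (Bhanot–Creutz mixed action) -/

section Adjoint

variable {d N : ℕ}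

/-- A unit lattice vector is not zero: `x + e_i ≠ x`. [folklore] -/
theorem add_single_ne_self (x : Site d) (i : Fin d) : x + Pi.single i (1 : ℤ) ≠ x := by
  intro h
  have h1 := congrFun h i
  simp at h1

/-- Distinct unit lattice vectors differ: `x + e_i = x + e_j → i = j`. [folklore] -/
theorem eq_of_add_single_eq {x : Site d} {i j : Fin d} (h : x + Pi.single i (1 : ℤ) = x + Pi.single j 1) : i = j := by
  by_contra hij
  have h1 := congrFun h i
  simp [hij] at h1

/-- **A plaquette is determined by its four links**: `plaquetteEdges` is injective. [folklore] -/
theorem plaquetteEdges_injective : Function.Injective (plaquetteEdges : ZdPlaquette d → Finset (ZdEdge d)) := by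
  rintro ⟨x, ⟨⟨i, j⟩, hij⟩⟩ ⟨x', ⟨⟨i', j'⟩, hij'⟩⟩ h
  have hij0 : i < j := hij
  have hij0' : i' < j' := hij'
  have h1 : ((x', i') : ZdEdge d) ∈ plaquetteEdges ((x, ⟨(i, j), hij⟩) : ZdPlaquette d) := by
    rw [h]; simp [plaquetteEdges]
  have h2 : ((x', j') : ZdEdge d) ∈ plaquetteEdges ((x, ⟨(i, j), hij⟩) : ZdPlaquette d) := by
    rw [h]; simp [plaquetteEdges]
  simp only [plaquetteEdges, Finset.mem_insert, Finset.mem_singleton, Prod.mk.injEq] at h1 h2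
  -- the directions
  have hi' : i' = i ∨ i' = j := by
    rcases h1 with ⟨-, e⟩ | ⟨-, e⟩ | ⟨-, e⟩ | ⟨-, e⟩ <;> simp [e]
  have hj' : j' = i ∨ j' = j := by
    rcases h2 with ⟨-, e⟩ | ⟨-, e⟩ | ⟨-, e⟩ | ⟨-, e⟩ <;> simp [e]
  obtain ⟨rfl, rfl⟩ : i' = i ∧ j' = j := by
    rcases hi' with rfl | rfl <;> rcases hj' with e | e
    · rw [e] at hij0'; exact absurd hij0' (lt_irrefl _)
    · exact ⟨rfl, e⟩
    · rw [e] at hij0'; exact absurd (hij0.trans hij0') (lt_irrefl _)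
    · rw [e] at hij0'; exact absurd hij0' (lt_irrefl _)
  -- the base point
  have hx : x' = x := by
    rcases h1 with ⟨e, -⟩ | ⟨-, e'⟩ | ⟨e, -⟩ | ⟨-, e'⟩
    · exact e
    · exact absurd e' hij0.ne
    · rcases h2 with ⟨e2, -⟩ | ⟨e2, -⟩ | ⟨-, e2'⟩ | ⟨e2, -⟩
      · exact e2
      · exact absurd (eq_of_add_single_eq (e.symm.trans e2)) hij0.ne'
      · exact absurd e2' hij0.ne'
      · exact e2
    · exact absurd e' hij0.ne
  subst hx
  rfl

/-- **The plaquette support family is translation covariant**: `plaquetteSupp (Λ + v) = plaquetteSupp Λ + v`.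
[folklore] -/
theorem plaquetteSupp_shift (v : Site d) (Λ : Finset (ZdEdge d)) :
    plaquetteSupp (Λ.map (edgeShift v).toEmbedding) =
      (plaquetteSupp Λ).map (Equiv.finsetCongr (edgeShift v)).toEmbedding := by
  rw [plaquetteSupp, plaquetteSupp, plaquettesTouching_map_edgeShift, Finset.image_image, Finset.map_eq_image,
    Finset.image_image]
  refine Finset.image_congr fun p _ => ?_
  simp only [Function.comp_apply, Equiv.coe_toEmbedding, Equiv.finsetCongr_apply]
  exact plaquetteEdges_shift v p.1 p.2

/-- `(X + v) − v = X` for finite link sets. [folklore] -/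
theorem map_edgeShift_map_neg (X : Finset (ZdEdge d)) (v : Site d) :
    (X.map (edgeShift v).toEmbedding).map (edgeShift (-v)).toEmbedding = X := by
  rw [Finset.map_map]
  have h : (edgeShift (d := d) v).toEmbedding.trans (edgeShift (-v)).toEmbedding = Function.Embedding.refl _ := by
    ext e : 1
    simp [edgeShift_apply]
  rw [h, Finset.map_refl]

/-- The translate of a plaquette link set is a plaquette link set, and conversely. [folklore] -/
theorem exists_plaquetteEdges_eq_map_iff (v : Site d) (X : Finset (ZdEdge d)) :
    (∃ p : ZdPlaquette d, plaquetteEdges p = X.map (edgeShift v).toEmbedding) ↔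
      ∃ p : ZdPlaquette d, plaquetteEdges p = X := by
  constructor
  · rintro ⟨p, hp⟩
    refine ⟨(p.1 + -v, p.2), ?_⟩
    rw [plaquetteEdges_shift (-v) p.1 p.2, show ((p.1, p.2) : ZdPlaquette d) = p from rfl, hp,
      map_edgeShift_map_neg]
  · rintro ⟨p, hp⟩
    exact ⟨(p.1 + v, p.2), by rw [plaquetteEdges_shift, show ((p.1, p.2) : ZdPlaquette d) = p from rfl, hp]⟩

/-- **The adjoint-plaquette witness is translation covariant**: `W_{X+v}(θ_v U) = W_X(U)` (the plaquette with
link set `X + v` is the translate of the plaquette with link set `X`, `plaquetteEdges_injective`; the plaquette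
observable is covariant, `plaquetteObs_add_configShift`). [folklore] -/
theorem adjointWitness_shift (t : ℝ) (v : Site d) (X : Finset (ZdEdge d))
    (U : LGConfig d (Matrix.specialUnitaryGroup (Fin N) ℂ)) :
    adjointWitness (N := N) t (X.map (edgeShift v).toEmbedding) (configShift v U) = adjointWitness t X U := by
  unfold adjointWitness
  by_cases h : ∃ p : ZdPlaquette d, plaquetteEdges p = X
  · have h' : ∃ p : ZdPlaquette d, plaquetteEdges p = X.map (edgeShift v).toEmbedding :=
      (exists_plaquetteEdges_eq_map_iff v X).2 h
    rw [dif_pos h', dif_pos h]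
    -- the chosen plaquettes are translates of each other
    set p := Classical.choose h with hp
    set p' := Classical.choose h' with hp'
    have hpX : plaquetteEdges p = X := Classical.choose_spec h
    have hp'X : plaquetteEdges p' = X.map (edgeShift v).toEmbedding := Classical.choose_spec h'
    have hpp : p' = (p.1 + v, p.2) := plaquetteEdges_injective (by rw [hp'X, plaquetteEdges_shift, hpX])
    rw [hpp, plaquetteObs_add_configShift]
  · have h' : ¬ ∃ p : ZdPlaquette d, plaquetteEdges p = X.map (edgeShift v).toEmbedding :=
      fun h'' => h ((exists_plaquetteEdges_eq_map_iff v X).1 h'')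
    rw [dif_neg h', dif_neg h]

/-- **The finite-volume Hamiltonians of the adjoint-plaquette witness are translation covariant.** [folklore] -/
theorem hamiltonianIn_adjointWitness_shift (t : ℝ) (Λ : Finset (ZdEdge d)) (v : Site d)
    (U : LGConfig d (Matrix.specialUnitaryGroup (Fin N) ℂ)) :
    hamiltonianIn (adjointWitness (N := N) t) plaquetteSupp (Λ.map (edgeShift v).toEmbedding) (configShift v U) =
      hamiltonianIn (adjointWitness t) plaquetteSupp Λ U :=
  Covariance.hamiltonianIn_shift (fun v X U => adjointWitness_shift t v X U) (fun v Λ => plaquetteSupp_shift v Λ) Λ v U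

/-- ★ **THE `SU(2)` BHANOT–CREUTZ MIXED ACTION at `β_W = 1/8`, `|t| ≤ 1/100`: ONE STATE, TRANSLATION INVARIANT.**
The unique DLR state of the member `S_W/…  + t Σ_p (Re tr U_p / 2)²` of rb-p1's row `su2_mixedAction_massGap_1_8`
satisfies `μ ∘ θ_v⁻¹ = μ` for every `v ∈ ℤ⁴`. [folklore] -/
theorem su2_mixedAction_oneState_translationInvariant {t : ℝ} (ht : |t| ≤ 1 / 100) :
    ∃ μ : Measure (LGConfig 4 (SUN 2)),
      perturbedGibbsMeasures (d := 4) (fundamentalRep (Fin 2)) (((2 : ℕ) : ℝ) * ((1 / 8 : ℝ) / 4))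
          (adjointWitness t) plaquetteSupp = {μ} ∧ IsZdTranslationInvariant μ :=
  oneState_translationInvariant_of_perturbedMassGapAt (su2_mixedAction_massGap_1_8 ht)
    (continuous_adjointWitness t) (dependsOn_adjointWitness t) (isSupportedBy_adjointWitness t)
    (fun Λ v U => hamiltonianIn_adjointWitness_shift t Λ v U)

end Adjoint

end Summit.Ventures.YMGap.RobustBall

end
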